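import Literature.MathematicalPhysics.QuantumLattice.AnisotropicSectors
import Literature.MathematicalPhysics.QuantumLattice.HubbardFermiSectorGeometry
import Literature.MathematicalPhysics.QuantumLattice.MatsubaraSectorPropagator
import Mathlib.Analysis.Calculus.ContDiff.Defs
import Mathlib.MeasureTheory.Integral.Bochner.Basic
import HarnessLib

/-!
# Benfatto–Giuliani–Mastropietro 2006, §2.1–§2.5: the multiscale set-up with a scale-dependent
dispersion relation `E_h`, and Lemmas 2.1, 2.2, 2.2a, 2.3, 2.2b (statements)

Topic `Literature/MathematicalPhysics/QuantumLattice/FermiRG` (typer-wave file F1a of the cell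
`gate-hubbard-kl`, source BGM06 = G. Benfatto, A. Giuliani, V. Mastropietro, *Fermi liquid behavior in
the 2D Hubbard model at low temperatures*, Ann. Henri Poincaré 7 (2006) 809–898, arXiv:cond-mat/0507686;
locators `p00NN:Lnn` = chunk `pNNNN.txt`, line, of the `lit read` render of the arXiv TeX — NOT printed
pages; the TeX equation labels `\Eq(2.36aa)` etc. are quoted as printed in the source).

## What the tree already has, and what this file adds

The tree formalises §2.2–§2.5 for the FIXED dispersion `E_h ≡ ε` (the `U = 0` geometry): the
Gallavotti–Nicolò cutoffs `gnCutoff`/`gnScaleCutoff`/`gnShell` ((2.9), (2.19), (2.28) as one-variable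
functions, `ScaleCutoffs.lean`, with `-- TODO(general form)`), the angular sectors and partitions of unity
`sectorWidth/Count/Center`, `sectorWeightCirc` ((2.45), (2.57)), the cutoffs `anisotropicCutoff`,
`isotropicCutoff` ((2.46), (2.58)), the Fermi radius `fermiRadius` and the moving frame `fermiTangent`,
`fermiNormal` ((2.47)), and it PROVES the fixed-dispersion, zero-temperature (continuum `k₀`) versions of
Lemma 2.2 (`sectorPropagator_decay`), Lemma 2.2a (`norm_sectorPropagator_zero_le`), Lemma 2.3
(`isoPropagator_decay`), Lemma 2.2b (`norm_isoPropagator_zero_le`), the `L¹` remarks (2.52a)/(2.52b) at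
`j = 0` (`sectorPropagator_l1`, `isoPropagator_l1`) and the finite-`β` dimensional bounds
(`norm_thermalSectorPropagator_le_of_scale`).  BGM's §2 statements, however, concern a SCALE-DEPENDENT
dispersion `E_h(k)` built inductively by (2.23) and controlled by the inductive smallness/smoothness
hypothesis (2.36) with the coupled-smallness device `c₀ = |h_β| U₀` — this is the general form the
tree's `TODO` defers, and the form the KL programme consumes.  This file therefore

* DEFINES, over an arbitrary dispersion family `E : ℤ → ℝ × (Fin 2 → ℝ) → ℂ` (`E h (k₀, k⃗)`), the
  general objects of §2.2–§2.5: `C_h⁻¹` (2.19) `bgmCutoffInv`, `f_h` (2.28) `bgmShell`, `ĝ^{(h)}` (2.27)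
  `bgmSingleScale`, the discrete derivatives (2.36aa) `bgmDiff`, the lattice `D_{β,L}` `bgmLattice`, the
  hypotheses (2.36)/(2.36a) as PREDICATES (`BGMSmoothnessLattice` — literal finite-`L` form — and
  `BGMSmoothness` — the formal `L = ∞` form of footnote ¹ used by Lemmas 2.1–2.3), `ε_h` (2.36c)
  `bgmEffDisp`, `a_h` (2.44) `bgmA`, `r_h` (2.43) `bgmRest`, the stopping scale `h_β` (2.31a)
  `IsBGMLastScale`, the polar radius `u_h(θ, e)` of the scale-`h` level curves `levelRadius` (= the
  tree's `fermiRadius` at `E_h ≡ ε`, `levelRadius_sqDispersion`), the frame (2.47) `polarTangent`,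
  `polarNormal` (= `fermiTangent`, `fermiNormal` at `E_h ≡ ε`, `polarTangent_fermiRadius`), the
  curvature `polarCurvature`, the sector functions `F_{h,ω}` `bgmSectorFn` and the finite-`β` sector
  propagators `g^{(h)}_ω` (2.49) / `ḡ^{(h)}_ω̄` (2.59) `bgmGenProp` (two-index: angular index `m = n` /
  `m = 2n`, as in `IsotropicSectors.lean`), `d_β` (2.52);
* STATES as named `Prop` facts (D-0014; licences F-001 … F-005 of the cell's FACT-LIST) Lemma 2.1
  (`BGM2006_Lemma_2_1`), Lemma 2.2 (`BGM2006_Lemma_2_2`), Lemma 2.2a (`BGM2006_Lemma_2_2a`), Lemma 2.3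
  (`BGM2006_Lemma_2_3`), Lemma 2.2b (`BGM2006_Lemma_2_2b`), each with the hypotheses (2.36), `|U| ≤ U₀`,
  `c₀ = |h_β|U₀` small, as printed, and each citing in its docstring the tree theorem proving the
  `E_h ≡ ε` case;
* records §2.1 (model, (2.1)–(2.5)) by the CONVENTION DICTIONARY below and the two conversion lemmas
  `two_mul_bgmPrintedDispersion_sub`, `bgmWindow_iff` — no new model object (the tree's
  `hubbardTorusWith 2 L 1 U μ`, `hubbardThermalTwoPoint`, `sqDispersion` are the model).

## Convention dictionary (BGM06 printed ↦ tree), as in `HubbardFermiLiquid.lean`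

BGM's Hamiltonian (1.1) is `Σ a⁺(-Δ/2 - μ')a + U' n↑n↓`, dispersion `ε₀(k) = 2 - cos k₁ - cos k₂`
((1.4)(c), hopping `½`), window `0 < μ' < μ₀ = (2-√2)/2` (Thm 1.1).  The tree's `sqDispersion k =
-2(cos k₁ + cos k₂)` has hopping `1`: `H_BGM = ½ H_tree` with `μ = 2μ' - 4`, `U = 2U'`, `β = β'/2`,
`k₀ = 2k₀'`, `e₀ = 2e₀'`, so that `-ik₀ + ε(k⃗) - μ = 2(-ik₀' + ε₀(k⃗) - μ')` and every cutoff
`H₀(γ^{-h}|·|)` with parameter `e₀` is BGM's with `e₀'`; the window becomes `-4 < μ < -2 - √2`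
(`bgmWindow_iff`).  All statements below are in the tree's variables; `γ = 4` throughout, written `4`,
with `γ^{h/2} = 2^h`, `γ^{3h/2} = 2^{3h}`, `γ^{5h/2} = 2^{5h}` for `h : ℤ`; the tree's scale index is
`n = -h : ℕ` (`bgmScaleIdx`).

## Remarks the referee should see (printed text vs typed form)

1. (2.36) is typed with the printed factor `|h|`; at `h = 0` its first line forces `E_{-1} = E_0` on the
   quantified momenta.  BGM use (2.36) for `h ≤ -1` in §3 ((3.2)); we keep the printed form (it only
   weakens the facts) and flag it here.
2. BGM print `Ō_h = {0, …, γ^{-(h-1)} - 1}` for the isotropic sectors; the partition of unity (2.57)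
   with centres `(ω̄ + ½)πγ^h` forces `|Ō_h| = 2γ^{-h} = sectorCount (2n)` (as in `IsotropicSectors.lean`);
   we use the latter.
3. (2.44) prints `a_h = (i/2)[(π/β)E_h(π/β,k⃗) - (π/β)E_h(-π/β,k⃗)] = i∂_{k₀}E_h(-π/β,k⃗)`; with (2.36aa)
   the right-hand identity reads `i(β/2π)[E_h(π/β,k⃗) - E_h(-π/β,k⃗)]`, which is what `bgmA` is.
4. Lemmas 2.2a/2.2b print only "fix `h ≤ 0`, `ω ∈ O_h`"; their proofs use the bounds on `a_h`, `r_h`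
   after (2.43), i.e. the standing hypotheses (2.36) + `c₀` small of §2.4–2.5, which the typed facts
   carry explicitly (same binder block as Lemma 2.2).
5. Footnote ¹ (p0008:L52): spatial discrete derivatives and `(2π/L)²Σ_k` are replaced "formally" by
   their `L → ∞` limits; `BGMSmoothness` is that formal form (genuine `k⃗`-derivatives, `k₀` discrete at
   the Matsubara frequencies, `E_h(k₀, ·)` smooth and `2π`-periodic), `BGMSmoothnessLattice` the literal one.
6. The displayed consequences (2.41a), (2.42), (2.42a), the bounds on `a_h`, `r_h` after (2.43), and the
   `L¹` remarks (2.52a)/(2.52b) are NOT separate facts (FACT-LIST §0.1): they are quoted in the docstrings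
   of the lemma they follow; (2.16) (= App. A1) and §2.6–§2.9 are other files of the wave (F2c, F1b, F2a).

Tree pointers for the Grassmann side of §2.1–§2.3 (cited, not restated): the Grassmann Gaussian
integration and the "addition principle" (2.2), (2.11)–(2.12), (2.26) = `GrassmannGaussianAddition.lean`;
the truncated expectations `𝓔ᵀ` (2.14), (2.31) = `GrassmannTruncatedExpectation.lean`; the kernel
representation (2.15) = `GrassmannKernels.kernel` / `SectorisedKernelNorm.positionKernel`; the effective
potential of the Hubbard torus = `HubbardEffectiveAction(CT).lean`; the ultraviolet bounds (2.16) are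
App. A1 (wave file F2c, FACT-LIST F-010), not restated here.

Everything declared here is a definition with a body, a proved lemma, or a named `Prop` fact; no
`sorry`, no axioms, no instances, no notation.

## Sources

* [BGM06] G. Benfatto, A. Giuliani, V. Mastropietro, Ann. Henri Poincaré 7 (2006) 809–898,
  arXiv:cond-mat/0507686, §2.1–§2.5. [BenfattoGiulianiMastropietro2006]
* [BGM03] G. Benfatto, A. Giuliani, V. Mastropietro, Ann. Henri Poincaré 4 (2003) 137–193, §2.3, §7
  (the same sectors for a fixed Fermi curve). [BenfattoGiulianiMastropietro2003]
-/

noncomputable section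

open Real Set Complex MeasureTheory
open scoped Topology

namespace Literature.MathematicalPhysics.QuantumLattice.FermiRG

/-! ### §2.1 (BGM06.S2.1, p0005:L94) — the model: conventions only, no new object -/

/-- BGM's printed dispersion `ε₀(k⃗) = 2 - cos k₁ - cos k₂` ((1.4)(c); hopping `½`). Recorded only to
state the dictionary; the tree's model is `hubbardTorusWith 2 L 1 U μ` with band `sqDispersion`.
BGM06.S2.1 · (1.4)(c) · p0002:L88. [cite: BenfattoGiulianiMastropietro2006, §1 (1.4)] -/
def bgmPrintedDispersion (k : Fin 2 → ℝ) : ℝ := 2 - Real.cos (k 0) - Real.cos (k 1)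

/-- **Dictionary**: `2(ε₀(k⃗) - μ') = ε(k⃗) - μ` with `ε = sqDispersion`, `μ = 2μ' - 4` (BGM's (1.1)/(1.4)(c)
versus the tree's hopping-`1` band). [cite: BenfattoGiulianiMastropietro2006, §1 (1.4)] -/
theorem two_mul_bgmPrintedDispersion_sub (k : Fin 2 → ℝ) (μ' : ℝ) :
    2 * (bgmPrintedDispersion k - μ') = sqDispersion k - (2 * μ' - 4) := by
  simp only [bgmPrintedDispersion, sqDispersion]
  ring

/-- **Dictionary**: BGM's window `0 < μ' < μ₀ = (2-√2)/2` (Thm 1.1, Lemma 2.1 item 3) is the tree's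
`-4 < μ < -2-√2` for `μ = 2μ' - 4`. BGM06.S2.1 · Thm 1.1 · p0003:L80. [cite: BenfattoGiulianiMastropietro2006, Thm 1.1 (hypothesis on μ)] -/
theorem bgmWindow_iff (μ' : ℝ) :
    (0 < μ' ∧ μ' < (2 - Real.sqrt 2) / 2) ↔ (-4 < 2 * μ' - 4 ∧ 2 * μ' - 4 < -2 - Real.sqrt 2) := by
  constructor <;> rintro ⟨h1, h2⟩ <;> constructor <;> linarith

/-- The tree's scale index `n = -h` of a BGM scale `h ≤ 0` (`γ^h = 4^{-n}`). [folklore] -/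
def bgmScaleIdx (h : ℤ) : ℕ := (-h).toNat

/-- The set `D_β` of fermionic Matsubara frequencies `k₀ = (2π/β)(n₀ + ½)` ((1.4)(b); the ultraviolet
restriction `|n₀| ≤ M` of §2.1 is removed, `M → ∞`, as BGM do after (2.8)). Same set as the tree's
`fermiMatsubara β`. BGM06.S2.1 · (1.4)(b) · p0002:L84. [cite: BenfattoGiulianiMastropietro2006, §1 (1.4)] -/
def matsubaraSet (β : ℝ) : Set ℝ := Set.range (fermiMatsubara β)

/-- The space-time momentum lattice `D_{β,L} = D_β × D_L`, `D_L = (2π/L)ℤ²` ((1.4)(a),(b); momenta are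
taken modulo `2π`, so all of `(2π/L)ℤ²` is listed). BGM06.S2.1 · (1.4) · p0002:L82.
[cite: BenfattoGiulianiMastropietro2006, §1 (1.4)] -/
def bgmLattice (β L : ℝ) : Set (ℝ × (Fin 2 → ℝ)) :=
  {p | p.1 ∈ matsubaraSet β ∧ ∀ i, ∃ n : ℤ, p.2 i = 2 * π / L * n}

/-! ### §2.2–§2.3 (BGM06.S2.2 p0006:L56, BGM06.S2.3 p0006:L148) — cutoffs with a dispersion family -/

/-- The denominator `-ik₀ + E_h(k) - μ` of the scale-`h` free measure (2.18) for a dispersion family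
`E` (`E h (k₀, k⃗)`). BGM06.S2.3 · (2.18) · p0007:L17. [cite: BenfattoGiulianiMastropietro2006, §2.3 (2.18)] -/
def bgmDenom (μ : ℝ) (E : ℤ → ℝ × (Fin 2 → ℝ) → ℂ) (h : ℤ) (p : ℝ × (Fin 2 → ℝ)) : ℂ :=
  -(Complex.I * (p.1 : ℂ)) + (E h p - (μ : ℂ))

/-- **(2.19)** `C_h⁻¹(k) = H₀[γ^{-h}|-ik₀ + E_h(k) - μ|]`, the tree's `gnScaleCutoff 4 e₀ h` composed
with the scale-`h` denominator — the "general form" deferred in `ScaleCutoffs.lean`. At `h = 0` with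
`E_0 ≡ ε` this is `χ(k) = H₀(√(k₀² + (ε - μ)²))` of (2.9)–(2.10). BGM06.S2.3 · (2.19) · p0007:L35.
[cite: BenfattoGiulianiMastropietro2006, §2.3 (2.19)] -/
def bgmCutoffInv (e₀ μ : ℝ) (E : ℤ → ℝ × (Fin 2 → ℝ) → ℂ) (h : ℤ) (p : ℝ × (Fin 2 → ℝ)) : ℝ :=
  gnScaleCutoff 4 e₀ h ‖bgmDenom μ E h p‖

/-- **(2.10)** the ultraviolet cutoff `f₁(k) = 1 - χ(k)`, `χ(k) = H₀(√(k₀² + [ε(k⃗) - μ]²))`, `H₀` the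
tree's `gnCutoff 4 e₀` ((2.9), `γ = 4`). BGM06.S2.2 · (2.9)–(2.10) · p0006:L71.
[cite: BenfattoGiulianiMastropietro2006, §2.2 (2.10)] -/
def bgmUVCutoff (e₀ μ : ℝ) (p : ℝ × (Fin 2 → ℝ)) : ℝ :=
  1 - gnCutoff 4 e₀ (Real.sqrt (p.1 ^ 2 + (sqDispersion p.2 - μ) ^ 2))

/-- **(2.28)** the single-scale cutoff with a moving dispersion,
`f_h(k) = H₀[γ^{-h}|-ik₀ + E_h(k) - μ|] - H₀[γ^{-h+1}|-ik₀ + E_{h-1}(k) - μ|] = C_h⁻¹[E_h] - C_{h-1}⁻¹[E_{h-1}]`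
(the two terms use DIFFERENT dispersions; for `E_h ≡ E_{h-1}` it is the tree's `gnShell`).
BGM06.S2.3 · (2.28) · p0007:L108. [cite: BenfattoGiulianiMastropietro2006, §2.3 (2.28)] -/
def bgmShell (e₀ μ : ℝ) (E : ℤ → ℝ × (Fin 2 → ℝ) → ℂ) (h : ℤ) (p : ℝ × (Fin 2 → ℝ)) : ℝ :=
  bgmCutoffInv e₀ μ E h p - bgmCutoffInv e₀ μ E (h - 1) p

/-- **(2.27)** the single-scale propagator `ĝ^{(h)}(k) = f_h(k)/(-ik₀ + E_{h-1}(k) - μ)` of the field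
`ψ^{(h)}` (Grassmann integration `P_{E_{h-1}, f_h⁻¹}`). BGM06.S2.3 · (2.27) · p0007:L101.
[cite: BenfattoGiulianiMastropietro2006, §2.3 (2.27)] -/
def bgmSingleScale (e₀ μ : ℝ) (E : ℤ → ℝ × (Fin 2 → ℝ) → ℂ) (h : ℤ) (p : ℝ × (Fin 2 → ℝ)) : ℂ :=
  ((bgmShell e₀ μ E h p : ℝ) : ℂ) / bgmDenom μ E (h - 1) p

/-- **(2.18)** the covariance `C_h⁻¹(k)/(-ik₀ + E_h(k) - μ)` of the scale-`≤ h` free measure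
`P_{E_h,C_h}(dψ^{(≤h)})`. BGM06.S2.3 · (2.18) · p0007:L17. [cite: BenfattoGiulianiMastropietro2006, §2.3 (2.18)] -/
def bgmCovariance (e₀ μ : ℝ) (E : ℤ → ℝ × (Fin 2 → ℝ) → ℂ) (h : ℤ) (p : ℝ × (Fin 2 → ℝ)) : ℂ :=
  ((bgmCutoffInv e₀ μ E h p : ℝ) : ℂ) / bgmDenom μ E h p

/-- **(2.20)** the localization operator on a family of kernels indexed by the number `l` of field
pairs: `ℒ W_{2l} = W_{2l}` for `l = 1, 2` and `0` for `l ≥ 3` (so `ℛ = 1 - ℒ` keeps exactly the kernels with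
`≥ 6` legs). BGM06.S2.3 · (2.20) · p0007:L50. [cite: BenfattoGiulianiMastropietro2006, §2.3 (2.20)] -/
def bgmLocalize {α : Type*} [Zero α] (W : ℕ → α) (l : ℕ) : α := if l = 1 ∨ l = 2 then W l else 0

/-- `ℛ = 1 - ℒ`: `ℛ W_{2l} = 0` for `l = 1, 2`, `= W_{2l}` for `l ≥ 3` (and `l = 0`). [cite: BenfattoGiulianiMastropietro2006, §2.3 (2.21)] -/
def bgmRenormalize {α : Type*} [Zero α] (W : ℕ → α) (l : ℕ) : α := if l = 1 ∨ l = 2 then 0 else W l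

/-- `ℒ + ℛ = 1` on kernel families ("We also define `ℛ` as `ℛ = 1 - ℒ`", (2.21)). [cite: BenfattoGiulianiMastropietro2006, §2.3 (2.20)–(2.21)] -/
theorem bgmLocalize_add_bgmRenormalize {α : Type*} [AddZeroClass α] (W : ℕ → α) (l : ℕ) :
    bgmLocalize W l + bgmRenormalize W l = W l := by
  unfold bgmLocalize bgmRenormalize
  split_ifs <;> simp

/-- **(2.23)** the dispersion recursion `E_{h-1}(k) = E_h(k) + C_h⁻¹(k) n̂_h(k)`, `n̂_h` the Fourier
transform of the quadratic local part `n_h` of (2.22), as a predicate on the pair of families `(E, n̂)`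
for the scales `h_β < h ≤ 0` (typed for all `h ≤ 0`). BGM06.S2.3 · (2.23) · p0007:L72.
[cite: BenfattoGiulianiMastropietro2006, §2.3 (2.23)] -/
def BGMDispersionRecursion (e₀ μ : ℝ) (E nhat : ℤ → ℝ × (Fin 2 → ℝ) → ℂ) : Prop :=
  ∀ h : ℤ, h ≤ 0 → ∀ p, E (h - 1) p = E h p + ((bgmCutoffInv e₀ μ E h p : ℝ) : ℂ) * nhat h p

/-- **(2.18), first step**: `E_0(k₀, k⃗) ≡ ε₀(k⃗)` (tree: `sqDispersion`). BGM06.S2.3 · (2.18) · p0007:L30.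
[cite: BenfattoGiulianiMastropietro2006, §2.3 (2.18)] -/
def BGMInitial (E : ℤ → ℝ × (Fin 2 → ℝ) → ℂ) : Prop := ∀ p, E 0 p = ((sqDispersion p.2 : ℝ) : ℂ)

/-- **(2.31a)** the stopping condition at scale `h`:
`γ^{h-1}e₀ < min{|k₀ - Im E_h(k)| : k ∈ D_{β,L}, C_h⁻¹(k) > 0}`. BGM06.S2.3 · (2.31a) · p0007:L139.
[cite: BenfattoGiulianiMastropietro2006, §2.3 (2.31a)] -/
def BGMStopCondition (β L e₀ μ : ℝ) (E : ℤ → ℝ × (Fin 2 → ℝ) → ℂ) (h : ℤ) : Prop :=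
  ∀ p ∈ bgmLattice β L, 0 < bgmCutoffInv e₀ μ E h p → (4 : ℝ) ^ (h - 1) * e₀ < |p.1 - (E h p).im|

/-- **`h_β`** ((2.31a)): "we iterate this procedure up to the FIRST scale `h_β` such that (2.31a)" — the
largest `h ≤ 0` satisfying the stopping condition.  BGM add (p0007:L143, p0010:L5): "by the properties of
`E_h` … `h_β` is finite and actually larger than `[log_γ(π/(2e₀β))]`" (under (2.36), if `U` is small) —
prose, not typed. BGM06.S2.3 · (2.31a) · p0007:L137. [cite: BenfattoGiulianiMastropietro2006, §2.3 (2.31a)] -/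
def IsBGMLastScale (β L e₀ μ : ℝ) (E : ℤ → ℝ × (Fin 2 → ℝ) → ℂ) (hβ : ℤ) : Prop :=
  hβ ≤ 0 ∧ BGMStopCondition β L e₀ μ E hβ ∧ ∀ h : ℤ, hβ < h → h ≤ 0 → ¬ BGMStopCondition β L e₀ μ E h

/-- **(2.30)/(2.33)** the free-energy bookkeeping `F_{L,β} = F_0 + Σ_{h=h_β}^0 (F̃_h + t_h)`.
BGM06.S2.4 · (2.33) · p0008:L1. [cite: BenfattoGiulianiMastropietro2006, §2.3 (2.33)] -/
def bgmFreeEnergySum (F₀ : ℝ) (Ftilde t : ℤ → ℝ) (hβ : ℤ) : ℝ :=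
  F₀ + ∑ h ∈ Finset.Icc hβ 0, (Ftilde h + t h)

/-! ### (2.34)–(2.36c): the Beta function, the inductive hypotheses, the effective dispersion -/

/-- **(2.34), `E`-component of the Beta function**: `β̂²_h(k) = E_{h-1}(k) - E_h(k)` (as a function of
the families; BGM regard it as a functional of `E_h, λ_h, …, E_0, λ_0, U`). BGM06.S2.4 · (2.34) · p0008:L10.
[cite: BenfattoGiulianiMastropietro2006, §2.3 (2.34)] -/
def bgmBetaE (E : ℤ → ℝ × (Fin 2 → ℝ) → ℂ) (h : ℤ) (p : ℝ × (Fin 2 → ℝ)) : ℂ := E (h - 1) p - E h p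

/-- **(2.34), `λ`-component of the Beta function**: `β⁴_h(x) = λ_{h-1}(x) - λ_h(x)` for a family of
quartic kernels `λ_h` valued in any additive group. BGM06.S2.4 · (2.34) · p0008:L10.
[cite: BenfattoGiulianiMastropietro2006, §2.3 (2.34)] -/
def bgmBetaLambda {X : Type*} [Sub X] (lam : ℤ → X) (h : ℤ) : X := lam (h - 1) - lam h

/-- **(2.35)** the naive smallness of the running coupling in momentum space,
`|λ̂_h(k₁, k₂, k₃, k₁ - k₂ + k₃)| ≤ U₀` (BGM: "a bit stronger" is needed, (2.71a) of §2.7).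
BGM06.S2.4 · (2.35) · p0008:L37. [cite: BenfattoGiulianiMastropietro2006, §2.3 (2.35)] -/
def BGMCouplingSup (U₀ : ℝ) (lamhat : ℤ → (Fin 3 → ℝ × (Fin 2 → ℝ)) → ℂ) (h : ℤ) : Prop :=
  ∀ k : Fin 3 → ℝ × (Fin 2 → ℝ), ‖lamhat h k‖ ≤ U₀

/-- The shift vectors of the three discrete derivatives (2.36aa): `(2π/β, 0)`, `(0, (2π/L)ê₁)`,
`(0, (2π/L)ê₂)`. [cite: BenfattoGiulianiMastropietro2006, §2.3 (2.36aa)] -/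
def bgmShift (β L : ℝ) (i : Fin 3) : ℝ × (Fin 2 → ℝ) :=
  if i = 0 then (2 * π / β, 0) else if i = 1 then (0, Pi.single 0 (2 * π / L)) else (0, Pi.single 1 (2 * π / L))

/-- The steps `2π/β`, `2π/L`, `2π/L` of (2.36aa). [cite: BenfattoGiulianiMastropietro2006, §2.3 (2.36aa)] -/
def bgmStep (β L : ℝ) (i : Fin 3) : ℝ := if i = 0 then 2 * π / β else 2 * π / L

/-- **(2.36aa)** the discrete derivative in direction `i ∈ {0,1,2}`:
`∂_{k₀}f(k) = (β/2π)[f(k₀ + 2π/β, k⃗) - f(k)]`, `∂_{k_j}f(k) = (L/2π)[f(k₀, k⃗ + (2π/L)ê_j) - f(k)]`.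
BGM06.S2.4 · (2.36aa) · p0008:L55. [cite: BenfattoGiulianiMastropietro2006, §2.3 (2.36aa)] -/
def bgmDiff (β L : ℝ) (i : Fin 3) (f : ℝ × (Fin 2 → ℝ) → ℂ) (p : ℝ × (Fin 2 → ℝ)) : ℂ :=
  ((bgmStep β L i)⁻¹ : ℝ) • (f (p + bgmShift β L i) - f p)

/-- Iterated discrete derivatives `∂_{k_{i₁}} ⋯ ∂_{k_{iₙ}}` (2.36aa). [cite: BenfattoGiulianiMastropietro2006, §2.3 (2.36aa)] -/
def bgmDiffIter (β L : ℝ) : List (Fin 3) → (ℝ × (Fin 2 → ℝ) → ℂ) → ℝ × (Fin 2 → ℝ) → ℂ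
  | [], f => f
  | i :: l, f => bgmDiff β L i (bgmDiffIter β L l f)

/-- Iterated discrete TIME derivative `∂_{k₀}^a` (step `2π/β`; the spatial step is unused). [cite: BenfattoGiulianiMastropietro2006, §2.3 (2.36aa)] -/
def bgmTimeDiffIter (β : ℝ) (a : ℕ) (f : ℝ × (Fin 2 → ℝ) → ℂ) : ℝ × (Fin 2 → ℝ) → ℂ :=
  bgmDiffIter β 1 (List.replicate a 0) f

/-- **(2.36) with (2.36aa), literal finite-`(β,L)` form**: for `h_β ≤ h ≤ 0` and `k ∈ D_{β,L}`,
`|E_h(k) - E_{h-1}(k)| ≤ C₀|U||h|γ^{2h}` and, for every `n ≥ 1` and directions `i₁,…,iₙ ∈ {0,1,2}`,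
`|∂_{k_{i₁}}⋯∂_{k_{iₙ}}(E_h - E_{h-1})(k)| ≤ Cₙ|U|²|h|γ^{(2-n)h}`.  A PREDICATE on `E` (the inductive
hypothesis), never asserted; see Remark 1 of the module doc for `h = 0`. BGM06.E2.36 · (2.36) · p0008:L46.
[cite: BenfattoGiulianiMastropietro2006, §2.3 (2.36)] -/
def BGMSmoothnessLattice (β L U : ℝ) (C : ℕ → ℝ) (hβ : ℤ) (E : ℤ → ℝ × (Fin 2 → ℝ) → ℂ) : Prop :=
  ∀ h : ℤ, hβ ≤ h → h ≤ 0 →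
    (∀ p ∈ bgmLattice β L, ‖E h p - E (h - 1) p‖ ≤ C 0 * |U| * |(h : ℝ)| * (4 : ℝ) ^ (2 * h)) ∧
    (∀ l : List (Fin 3), l ≠ [] → ∀ p ∈ bgmLattice β L,
      ‖bgmDiffIter β L l (fun q => E h q - E (h - 1) q) p‖ ≤
        C l.length * |U| ^ 2 * |(h : ℝ)| * (4 : ℝ) ^ ((2 - (l.length : ℤ)) * h))

/-- The mixed partial derivative `∂_{k_{i₁}}⋯∂_{k_{i_b}} g(k⃗)` of a function on `ℝ²`, as the iterated
Fréchet derivative evaluated on coordinate vectors (for `g ∈ C^b` this is the classical mixed partial).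
[folklore] -/
def mixedPartial {b : ℕ} (i : Fin b → Fin 2) (g : (Fin 2 → ℝ) → ℂ) (k : Fin 2 → ℝ) : ℂ :=
  iteratedFDeriv ℝ b g k (fun j => Pi.single (i j) (1 : ℝ))

/-- **(2.36), formal `L = ∞` form** (footnote ¹, Remark 5): `E_h(k₀, ·)` is smooth and `2π`-periodic on
`ℝ²`; for `h_β ≤ h ≤ 0`, `k₀ ∈ D_β`, `k⃗ ∈ ℝ²`: `|E_h - E_{h-1}| ≤ C₀|U||h|γ^{2h}` and, for `a + b ≥ 1`
(`a` discrete `k₀`-derivatives of step `2π/β`, `b` genuine spatial partials),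
`|∂_{k₀}^a ∂_{k_{i₁}}⋯∂_{k_{i_b}}(E_h - E_{h-1})(k)| ≤ C_{a+b}|U|²|h|γ^{(2-a-b)h}`.  This is the
hypothesis "(2.36) is satisfied for `h_β ≤ h ≤ 0`" of Lemmas 2.1–2.3 / 2.5 / Thm 2.1.
BGM06.E2.36 · (2.36) · p0008:L46. [cite: BenfattoGiulianiMastropietro2006, §2.3 (2.36)] -/
def BGMSmoothness (β U : ℝ) (C : ℕ → ℝ) (hβ : ℤ) (E : ℤ → ℝ × (Fin 2 → ℝ) → ℂ) : Prop :=
  (∀ (h : ℤ) (k₀ : ℝ) (m : ℕ), ContDiff ℝ m (fun k : Fin 2 → ℝ => E h (k₀, k))) ∧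
  (∀ (h : ℤ) (k₀ : ℝ) (k : Fin 2 → ℝ) (z : Fin 2 → ℤ),
      E h (k₀, k + fun i => 2 * π * (z i : ℝ)) = E h (k₀, k)) ∧
  ∀ h : ℤ, hβ ≤ h → h ≤ 0 →
    (∀ k₀ ∈ matsubaraSet β, ∀ k : Fin 2 → ℝ,
      ‖E h (k₀, k) - E (h - 1) (k₀, k)‖ ≤ C 0 * |U| * |(h : ℝ)| * (4 : ℝ) ^ (2 * h)) ∧
    (∀ (a b : ℕ), 1 ≤ a + b → ∀ (i : Fin b → Fin 2), ∀ k₀ ∈ matsubaraSet β, ∀ k : Fin 2 → ℝ,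
      ‖mixedPartial i (fun k' => bgmTimeDiffIter β a (fun q => E h q - E (h - 1) q) (k₀, k')) k‖ ≤
        C (a + b) * |U| ^ 2 * |(h : ℝ)| * (4 : ℝ) ^ ((2 - ((a + b : ℕ) : ℤ)) * h))

/-- **(2.36a)** the symmetries of `E_h` from parity and complex conjugation:
`E_h(k₀, k⃗) = E_h(k₀, -k⃗)` and `E_h(k₀, k⃗) = E_h(-k₀, k⃗)^*`. BGM06.E2.36 · (2.36a) · p0008:L70.
[cite: BenfattoGiulianiMastropietro2006, §2.3 (2.36a)] -/
def BGMSymmetry (E : ℤ → ℝ × (Fin 2 → ℝ) → ℂ) : Prop :=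
  ∀ (h : ℤ) (k₀ : ℝ) (k : Fin 2 → ℝ),
    E h (k₀, -k) = E h (k₀, k) ∧ E h (k₀, k) = (starRingEnd ℂ) (E h (-k₀, k))

/-- **(2.36c)** the effective dispersion on scale `h`, `ε_h(k⃗) = ½[E_h(π/β, k⃗) + E_h(-π/β, k⃗)]` — real
by (2.36a) (Remark p0008:L118); typed as the real part of the printed average (equal to it under
`BGMSymmetry`, `bgmEffDisp_eq_of_symmetry`). BGM06.S2.4 · (2.36c) · p0008:L112.
[cite: BenfattoGiulianiMastropietro2006, §2.4 (2.36c)] -/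
def bgmEffDisp (β : ℝ) (E : ℤ → ℝ × (Fin 2 → ℝ) → ℂ) (h : ℤ) (k : Fin 2 → ℝ) : ℝ :=
  ((E h (π / β, k) + E h (-(π / β), k)) / 2).re

/-- Under (2.36a) the printed average is real and equals `ε_h`. [cite: BenfattoGiulianiMastropietro2006, §2.4 Remark after (2.36c)] -/
theorem bgmEffDisp_eq_of_symmetry {E : ℤ → ℝ × (Fin 2 → ℝ) → ℂ} (hE : BGMSymmetry E) (β : ℝ) (h : ℤ)
    (k : Fin 2 → ℝ) : ((bgmEffDisp β E h k : ℝ) : ℂ) = (E h (π / β, k) + E h (-(π / β), k)) / 2 := by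
  have hc : (starRingEnd ℂ) ((E h (π / β, k) + E h (-(π / β), k)) / 2) =
      (E h (π / β, k) + E h (-(π / β), k)) / 2 := by
    have h1 := (hE h (π / β) k).2
    have h2 := (hE h (-(π / β)) k).2
    rw [neg_neg] at h2
    rw [map_div₀, map_add, ← h1, ← h2, map_ofNat]
    ring
  rw [bgmEffDisp]
  exact Complex.conj_eq_iff_re.mp hc

/-- `ε_h` is even in `k⃗` under (2.36a) (Remark p0008:L118). [cite: BenfattoGiulianiMastropietro2006, §2.4 Remark after (2.36c)] -/
theorem bgmEffDisp_neg {E : ℤ → ℝ × (Fin 2 → ℝ) → ℂ} (hE : BGMSymmetry E) (β : ℝ) (h : ℤ)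
    (k : Fin 2 → ℝ) : bgmEffDisp β E h (-k) = bgmEffDisp β E h k := by
  simp only [bgmEffDisp, (hE h _ k).1]

/-- **(2.44)** `a_h(k⃗) = i∂_{k₀}E_h(-π/β, k⃗) = i(β/2π)[E_h(π/β, k⃗) - E_h(-π/β, k⃗)]` (Remark 3 of the
module doc on the printed middle expression); real by (2.36a) (p0010:L1). BGM06.S2.4 · (2.44) · p0009:L150.
[cite: BenfattoGiulianiMastropietro2006, §2.4 (2.44)] -/
def bgmA (β : ℝ) (E : ℤ → ℝ × (Fin 2 → ℝ) → ℂ) (h : ℤ) (k : Fin 2 → ℝ) : ℂ :=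
  Complex.I * bgmDiff β 1 0 (E h) (-(π / β), k)

/-- **(2.43)** the rest `r_h(k)` defined by `-ik₀ + E_{h-1}(k) - μ = -ik₀[1 + a_h(k⃗)] + ε_h(k⃗) + r_h(k) - μ`,
i.e. `r_h(k) = E_{h-1}(k) + ik₀a_h(k⃗) - ε_h(k⃗)`.  BGM (p0010:L2–4): "there exists `C > 0` such that
`|a_h(k⃗)| ≤ C|U|` and `|r_h(k)| ≤ C|U||h|γ^{2h}` for any `k` in the support of `f_h(k)`" (from (2.36),
(2.42); not typed separately, Remark 6). BGM06.S2.4 · (2.43) · p0009:L146. [cite: BenfattoGiulianiMastropietro2006, §2.4 (2.43)] -/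
def bgmRest (β : ℝ) (E : ℤ → ℝ × (Fin 2 → ℝ) → ℂ) (h : ℤ) (p : ℝ × (Fin 2 → ℝ)) : ℂ :=
  E (h - 1) p + Complex.I * (p.1 : ℂ) * bgmA β E h p.2 - ((bgmEffDisp β E h p.2 : ℝ) : ℂ)

/-- (2.43) as an identity: `-ik₀ + E_{h-1}(k) - μ = -ik₀[1 + a_h] + ε_h + r_h - μ`. [cite: BenfattoGiulianiMastropietro2006, §2.4 (2.43)] -/
theorem bgmDenom_sub_one_eq (μ β : ℝ) (E : ℤ → ℝ × (Fin 2 → ℝ) → ℂ) (h : ℤ) (p : ℝ × (Fin 2 → ℝ)) :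
    bgmDenom μ E (h - 1) p =
      -(Complex.I * (p.1 : ℂ)) * (1 + bgmA β E h p.2) + ((bgmEffDisp β E h p.2 : ℝ) : ℂ) +
        bgmRest β E h p - (μ : ℂ) := by
  simp only [bgmDenom, bgmRest]
  ring

/-! ### §2.4 (BGM06.S2.4, p0008:L109) — the Fermi surface at scale `h`: polar radius, frame, curvature -/

/-- The defining property of the polar radius of the level `lev` of a dispersion `e` along the ray of
angle `θ`: `0 ≤ t ≤ π/2` and `e(t·dir θ) = lev` (same shape as the tree's `IsFermiRadius`, which is the
case `e = sqDispersion`); Lemma 2.1 (1): "`ε_h(k⃗) - μ = e` … can be represented in polar coordinates as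
`p⃗ = u_h(θ,e)e⃗_r(θ)`". [cite: BenfattoGiulianiMastropietro2006, §2.4 Lemma 2.1] -/
def IsLevelRadius (e : (Fin 2 → ℝ) → ℝ) (lev θ t : ℝ) : Prop := (0 ≤ t ∧ t ≤ π / 2) ∧ e (t • dir θ) = lev

/-- **`u_h(θ, e)`**: the polar radius of the curve `Σ^{(h)}(e) = {ε_h(k⃗) - μ = e}` (Lemma 2.1 item 1:
`p⃗ = u_h(θ, e)e⃗_r(θ)`), Hilbert's `ε` of `IsLevelRadius` (junk when the ray meets no root in `[0, π/2]`;
Lemma 2.1 asserts existence and uniqueness in BGM's regime). Use with `e = bgmEffDisp β E h`,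
`lev = μ + e`; `p⃗_F^{(h)}(θ) = u_h(θ, 0) dir θ`. BGM06.L2.1 · Lemma 2.1 (1) · p0009:L44.
[cite: BenfattoGiulianiMastropietro2006, §2.4 Lemma 2.1] -/
def levelRadius (e : (Fin 2 → ℝ) → ℝ) (lev θ : ℝ) : ℝ := Classical.epsilon (IsLevelRadius e lev θ)

/-- At `E_h ≡ ε` the level radius IS the tree's Fermi radius `u(θ) = u₀(θ) = |p⃗_F^{(0)}(θ)|` (§2.4: "we put
`u₀(θ,0)e⃗_r(θ) = p⃗_F^{(0)}(θ)`", p0009:L30), definitionally. [cite: BenfattoGiulianiMastropietro2006, §2.4 (before Lemma 2.1)] -/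
theorem levelRadius_sqDispersion (μ θ : ℝ) : levelRadius sqDispersion μ θ = fermiRadius μ θ := rfl

/-- The unit vector `e⃗_t(θ) = (-sin θ, cos θ)` ((2.47)). [cite: BenfattoGiulianiMastropietro2006, §2.5 (2.47)] -/
def dirPerp (θ : ℝ) : Fin 2 → ℝ := ![-Real.sin θ, Real.cos θ]

/-- `√(u(θ)² + u'(θ)²)` for a polar radius function `u` ((2.47) denominators). [cite: BenfattoGiulianiMastropietro2006, §2.5 (2.47)] -/
def polarSpeed (u : ℝ → ℝ) (θ : ℝ) : ℝ := Real.sqrt (u θ ^ 2 + deriv u θ ^ 2)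

/-- **(2.47)** the unit tangent `τ⃗(θ) = (u'e⃗_r + u e⃗_t)/√(u'² + u²)` of the polar curve `θ ↦ u(θ)e⃗_r(θ)`
(`τ⃗_h` for `u = u_h`). BGM06.S2.4 · (2.47) · p0010:L60. [cite: BenfattoGiulianiMastropietro2006, §2.5 (2.47)] -/
def polarTangent (u : ℝ → ℝ) (θ : ℝ) : Fin 2 → ℝ :=
  (polarSpeed u θ)⁻¹ • (deriv u θ • dir θ + u θ • dirPerp θ)

/-- **(2.47)** the outgoing unit normal `n⃗(θ) = (u e⃗_r - u'e⃗_t)/√(u'² + u²)` (`n⃗_h` for `u = u_h`).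
BGM06.S2.4 · (2.47) · p0010:L62. [cite: BenfattoGiulianiMastropietro2006, §2.5 (2.47)] -/
def polarNormal (u : ℝ → ℝ) (θ : ℝ) : Fin 2 → ℝ :=
  (polarSpeed u θ)⁻¹ • (u θ • dir θ - deriv u θ • dirPerp θ)

/-- The curvature `1/r(θ)` of the polar curve `ρ = u(θ)`: `(u² + 2u'² - u u'')/(u² + u'²)^{3/2}`
(Lemma 2.1: "if `r_h(θ, e)` is the curvature radius, `r_h(θ,e)⁻¹ ≥ c`"). [folklore] -/
def polarCurvature (u : ℝ → ℝ) (θ : ℝ) : ℝ :=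
  (u θ ^ 2 + 2 * deriv u θ ^ 2 - u θ * deriv (deriv u) θ) / polarSpeed u θ ^ 3

/-- The Euclidean pairing on `ℝ²` (coordinates `x'₁ = x⃗·n⃗`, `x'₂ = x⃗·τ⃗` of (2.46), (2.51)). [folklore] -/
def dot2 (a b : Fin 2 → ℝ) : ℝ := a 0 * b 0 + a 1 * b 1

/-- Consistency with the tree frame: for `E_h ≡ ε` and `-4 < μ < -2-√2`, `polarTangent (fermiRadius μ)`
is `fermiTangent μ` of `HubbardFermiSectorGeometry` ((2.47) at `h = 0`). [cite: BenfattoGiulianiMastropietro2006, §2.5 (2.47)] -/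
theorem polarTangent_fermiRadius {μ : ℝ} (hμ₁ : -4 < μ) (hμ₂ : μ < -2 - Real.sqrt 2) (θ : ℝ) :
    polarTangent (fermiRadius μ) θ = fermiTangent μ θ := by
  have hs : polarSpeed (fermiRadius μ) θ = fermiSpeed μ θ := by
    rw [polarSpeed, fermiSpeed, deriv_fermiRadius hμ₁ hμ₂]
  rw [polarTangent, fermiTangent, hs, deriv_fermiRadius hμ₁ hμ₂]
  congr 1
  ext i
  fin_cases i
  · simp [fermiVX, fermiVY, dirPerp]; ring
  · simp [fermiVX, fermiVY, dirPerp]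

/-- Consistency with the tree frame, normal vector ((2.47) at `h = 0`). [cite: BenfattoGiulianiMastropietro2006, §2.5 (2.47)] -/
theorem polarNormal_fermiRadius {μ : ℝ} (hμ₁ : -4 < μ) (hμ₂ : μ < -2 - Real.sqrt 2) (θ : ℝ) :
    polarNormal (fermiRadius μ) θ = fermiNormal μ θ := by
  have hs : polarSpeed (fermiRadius μ) θ = fermiSpeed μ θ := by
    rw [polarSpeed, fermiSpeed, deriv_fermiRadius hμ₁ hμ₂]
  rw [polarNormal, fermiNormal, hs, deriv_fermiRadius hμ₁ hμ₂]
  congr 1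
  ext i
  fin_cases i
  · simp [fermiVX, fermiVY, dirPerp]; ring
  · simp [fermiVX, fermiVY, dirPerp]

/-- The fundamental zone `[-π, π]²` (domain of `∫dk⃗'` in (2.49), of the curves `Σ^{(h)}(e)` in (2.39)). [folklore] -/
def zoneSq : Set (Fin 2 → ℝ) := Set.pi Set.univ fun _ => Set.Icc (-π) π

/-- BGM's range of the auxiliary energy parameter: "`e₀ < μ₀ - μ'`" (§2.4 item 1, p0008:L125; in tree
variables `e₀ < -2 - √2 - μ`) together with `0 < e₀` ((2.9)) and `μ - e₀ > -4` (the level `μ - e` must lie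
in the band for item 1 to hold at `e = -e₀`; implicit in the printed "for `|e| ≤ e₀`, `ε₀(k⃗) - μ = e`
defines a convex curve"). [cite: BenfattoGiulianiMastropietro2006, §2.4 item 1] -/
def BGMAdmissibleE0 (μ e₀ : ℝ) : Prop := 0 < e₀ ∧ e₀ < -2 - Real.sqrt 2 - μ ∧ e₀ < μ + 4

/-- **Lemma 2.1 of BGM06** (the Fermi surface at scale `h` keeps the convexity, transversality and
no-umklapp properties (2.37)–(2.39) of the free one).  Printed: *Assume (2.36) for `h_β ≤ h ≤ 0` and
`|U| ≤ U₀`, with `c₀ = |h_β|U₀` small enough. Then there exist constants `ē, c, c₁, c₂` such that: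
(1) if `|e| ≤ ē`, `ε_h(k⃗) - μ = e` defines a convex curve `Σ^{(h)}(e)` encircling the origin and symmetric
by reflection with respect to it, representable in polar coordinates as `p⃗ = u_h(θ,e)e⃗_r(θ)`, with
`u_h(θ,e) ≥ c > 0` and curvature radius `r_h(θ,e)⁻¹ ≥ c > 0` (2.40); (2) if `|e| ≤ ē` and
`p⃗ = u_h(θ,e)e⃗_r(θ)` then `0 < c₁ ≤ ∇ε_h(p⃗)·e⃗_r(θ) ≤ c₂` (2.41); (3) if `μ' < μ₀ = (2-√2)/2` and
`|e| ≤ ē` then `n ≤ 4`, `k⃗_i ∈ Σ^{(h)}(e)`, `i = 1,…,2n` ⟹ `|Σ_i k⃗_i| < 2π` (2.40a).*  Remark (p0009:L66):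
one may take `ē = e₀/2`, `c = c⁰/2`, `c₁ = c₁⁰/2`, `c₂ = 3c₂⁰/2` (the constants of (2.37)–(2.38) for `ε₀`).
Displayed consequences NOT typed separately (Remark 6): (2.41a) `|ε_h - ε₀| ≤ C₀'|U|`,
`|∇ε_h - ∇ε₀| ≤ C₁'|U|²`, `|∂²ε_h - ∂²ε₀| ≤ C₂c₀²`; (2.42) the same for `E_h - E_0` and
`|∂ⁿ(E_h - E_0)| ≤ Cₙ'|U|²|h|γ^{(2-n)h}` (`n ≥ 3`); (2.42a) `f_h(k) ≠ 0 ⟹ K⁻¹e₀γ^h ≤ |k₀| + |ε_h(k⃗) - μ| ≤ Ke₀γ^h`.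
Typed in tree variables (`-4 < μ < -2-√2` is BGM's `μ' < μ₀`), formal `L = ∞` hypotheses
`BGMSmoothness` (Remark 5), the curve encoded by its polar radius `u = levelRadius (ε_h) (μ+e)`:
`u ∈ C²`, `u(θ+π) = u(θ)` (reflection symmetry), the level set in `[-π,π]²` is exactly the polar graph,
`u ≥ c`, `polarCurvature u ≥ c` (convexity with curvature radius `≤ 1/c`), the radial derivative as the
Fréchet derivative along `dir θ`.  The tree PROVES the `E_h ≡ ε` (`U = 0`) case: `fermiRadius_pos`,
`continuous_fermiRadius`, `HubbardFermiCurvature`, `radial_deviation_le`,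
`HubbardUmklappKinematics.not_sum_eq_of_pos` (FACT-LIST F-001: FACT-unless-TREE, ref-2 rules).
BGM06.L2.1 · Lemma 2.1 · p0009:L39. [cite: BenfattoGiulianiMastropietro2006, §2.4 Lemma 2.1] -/
def BGM2006_Lemma_2_1 : Prop :=
  ∀ (μ e₀ : ℝ), -4 < μ → μ < -2 - Real.sqrt 2 → BGMAdmissibleE0 μ e₀ → ∀ (C : ℕ → ℝ),
    ∃ c₀ ebar c c₁ c₂ : ℝ, 0 < c₀ ∧ 0 < ebar ∧ 0 < c ∧ 0 < c₁ ∧ c₁ ≤ c₂ ∧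
    ∀ (β U₀ U : ℝ) (hβ : ℤ), 0 < β → hβ ≤ 0 → |U| ≤ U₀ → |(hβ : ℝ)| * U₀ ≤ c₀ →
    ∀ E : ℤ → ℝ × (Fin 2 → ℝ) → ℂ, BGMInitial E → BGMSymmetry E → BGMSmoothness β U C hβ E →
    ∀ h : ℤ, hβ ≤ h → h ≤ 0 →
      -- (1), (2.40): the curves `Σ^{(h)}(e)`, `|e| ≤ ē`
      (∀ e : ℝ, |e| ≤ ebar →
        ContDiff ℝ 2 (levelRadius (bgmEffDisp β E h) (μ + e)) ∧
        (∀ θ : ℝ, levelRadius (bgmEffDisp β E h) (μ + e) (θ + π) = levelRadius (bgmEffDisp β E h) (μ + e) θ) ∧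
        (∀ θ : ℝ, IsLevelRadius (bgmEffDisp β E h) (μ + e) θ (levelRadius (bgmEffDisp β E h) (μ + e) θ)) ∧
        (∀ k ∈ zoneSq, bgmEffDisp β E h k = μ + e ↔
          ∃ θ : ℝ, k = levelRadius (bgmEffDisp β E h) (μ + e) θ • dir θ) ∧
        (∀ θ : ℝ, c ≤ levelRadius (bgmEffDisp β E h) (μ + e) θ) ∧
        (∀ θ : ℝ, c ≤ polarCurvature (levelRadius (bgmEffDisp β E h) (μ + e)) θ)) ∧
      -- (2), (2.41): transversality of the radial derivative on the curves
      (∀ (e θ : ℝ), |e| ≤ ebar →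
        c₁ ≤ (fderiv ℝ (fun k => bgmEffDisp β E h k) (levelRadius (bgmEffDisp β E h) (μ + e) θ • dir θ)) (dir θ) ∧
        (fderiv ℝ (fun k => bgmEffDisp β E h k) (levelRadius (bgmEffDisp β E h) (μ + e) θ • dir θ)) (dir θ) ≤ c₂) ∧
      -- (3), (2.40a): no umklapp with `n ≤ 4` quasi-particles on the curves
      (∀ e : ℝ, |e| ≤ ebar → ∀ n : ℕ, n ≤ 4 → ∀ k : Fin (2 * n) → Fin 2 → ℝ,
        (∀ j, k j ∈ zoneSq ∧ bgmEffDisp β E h (k j) = μ + e) →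
          Real.sqrt ((∑ j, k j 0) ^ 2 + (∑ j, k j 1) ^ 2) < 2 * π)

/-! ### §2.5 (BGM06.S2.3/S2.4 sector rows; p0010:L21–L106) — sector functions and sector propagators -/

/-- **(2.45)–(2.46), general form** the anisotropic support functions `F_{h,ω}(k) = f_h(k)ζ_{h,ω}(θ(k⃗))`
with the moving-dispersion `f_h` of (2.28) and the tree's angular partition `sectorWeightCirc n ω`
(`θ_{h,ω} = (ω+½)πγ^{h/2} = sectorCenter n ω`, `O_h ≃ range (sectorCount n)`, `n = -h`), and — with
angular index `m` in place of `n` — the isotropic ones `F̄_{h,ω̄} = f_hζ̄_{h,ω̄}` of (2.57) (`m = 2n`,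
Remark 2 of the module doc).  For `E_h ≡ ε` these are the tree's `anisotropicCutoff` / `isotropicCutoff`
up to the continuum-vs-family bookkeeping. BGM06.S2.3 · (2.45)–(2.46), (2.57) · p0010:L33.
[cite: BenfattoGiulianiMastropietro2006, §2.5 (2.45)–(2.46)] -/
def bgmSectorFn (e₀ μ : ℝ) (E : ℤ → ℝ × (Fin 2 → ℝ) → ℂ) (h : ℤ) (m : ℕ) (ω : ℤ)
    (p : ℝ × (Fin 2 → ℝ)) : ℝ :=
  bgmShell e₀ μ E h p * sectorWeightCirc m ω (polarAngle p.2)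

/-- **(2.45), third property, general form**: `Σ_{ω ∈ O} F_{h,ω} = f_h` for every angular index `m`
(`|O| = sectorCount m`). [cite: BenfattoGiulianiMastropietro2006, §2.5 (2.45)] -/
theorem sum_bgmSectorFn (e₀ μ : ℝ) (E : ℤ → ℝ × (Fin 2 → ℝ) → ℂ) (h : ℤ) (m : ℕ) (p : ℝ × (Fin 2 → ℝ)) :
    ∑ ω ∈ Finset.range (sectorCount m), bgmSectorFn e₀ μ E h m ω p = bgmShell e₀ μ E h p := by
  simp only [bgmSectorFn, ← Finset.mul_sum, sum_sectorWeightCirc_eq_one, mul_one]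

/-- `d_β(x₀) = (β/π) sin(πx₀/β)` ((2.52): the `β`-periodic substitute of `|x₀|`). BGM06.E2.52 · (2.52) · p0010:L118.
[cite: BenfattoGiulianiMastropietro2006, §2.5 Lemma 2.2 (2.52)] -/
def bgmDbeta (β x₀ : ℝ) : ℝ := β / π * Real.sin (π * x₀ / β)

/-- **(2.49)/(2.59), general form** the finite-temperature single-scale sector propagator with angular
index `m` (`m = n`: the anisotropic `g^{(h)}_ω` of (2.49); `m = 2n`: the isotropic `ḡ^{(h)}_ω̄` of (2.59)):
`(1/β) Σ_{k₀ ∈ D_β} ∫_{[-π,π]²} dk⃗'/(2π)² e^{-i(k₀x₀ + k⃗'·x⃗)} F_{h,ω}(k₀, k⃗' + p⃗_F) / (-ik₀ + E_{h-1}(k₀, k⃗' + p⃗_F) - μ)`,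
`p⃗_F = p⃗_F^{(h)}(θ_{m,ω}) = u_h(θ_{m,ω}, 0) dir θ_{m,ω}` the scale-`h` Fermi point of the sector centre,
at lattice sites `x⃗ ∈ ℤ²` and `x₀ ∈ ℝ` (the Matsubara sum as a `tsum` over `ℤ`, a finite sum on the
support of `f_h` as in `MatsubaraSectorPropagator.thermalGenPropagator`).  For `E_h ≡ ε` compare the
tree's `thermalSectorPropagator` (finite `β`) / `sectorPropagator`, `isoPropagator` (continuum `k₀`).
BGM06.E2.49 · (2.49), (2.59) · p0010:L72, p0011:L133. [cite: BenfattoGiulianiMastropietro2006, §2.5 (2.49)] -/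
def bgmGenProp (β e₀ μ : ℝ) (E : ℤ → ℝ × (Fin 2 → ℝ) → ℂ) (h : ℤ) (m : ℕ) (ω : ℕ) (x₀ : ℝ)
    (x : Fin 2 → ℤ) : ℂ :=
  ((1 / β : ℝ) : ℂ) *
    ∑' j : ℤ, ∫ k in zoneSq,
      Complex.exp (-(Complex.I *
          ((fermiMatsubara β j * x₀ + dot2 k (fun i => (x i : ℝ)) : ℝ) : ℂ))) *
        (((bgmSectorFn e₀ μ E h m ω
              (fermiMatsubara β j, k + levelRadius (bgmEffDisp β E h) μ (sectorCenter m ω) • dir (sectorCenter m ω)) : ℝ) : ℂ) /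
          bgmDenom μ E (h - 1)
            (fermiMatsubara β j, k + levelRadius (bgmEffDisp β E h) μ (sectorCenter m ω) • dir (sectorCenter m ω))) /
        (((2 * π) ^ 2 : ℝ) : ℂ)

/-- **(2.49)** the anisotropic sector propagator `g^{(h)}_ω` (angular index `n = -h`). [cite: BenfattoGiulianiMastropietro2006, §2.5 (2.49)] -/
abbrev bgmSectorProp (β e₀ μ : ℝ) (E : ℤ → ℝ × (Fin 2 → ℝ) → ℂ) (h : ℤ) (ω : ℕ) (x₀ : ℝ) (x : Fin 2 → ℤ) : ℂ :=
  bgmGenProp β e₀ μ E h (bgmScaleIdx h) ω x₀ x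

/-- **(2.59)** the isotropic sector propagator `ḡ^{(h)}_ω̄` (angular index `2n`: width `πγ^h`). [cite: BenfattoGiulianiMastropietro2006, §2.5 (2.59)] -/
abbrev bgmIsoProp (β e₀ μ : ℝ) (E : ℤ → ℝ × (Fin 2 → ℝ) → ℂ) (h : ℤ) (ω : ℕ) (x₀ : ℝ) (x : Fin 2 → ℤ) : ℂ :=
  bgmGenProp β e₀ μ E h (2 * bgmScaleIdx h) ω x₀ x

/-- **Lemma 2.2 of BGM06** (decay of the anisotropic sector propagators for a moving dispersion).
Printed: *Assume the bounds (2.36) are valid and `c₀ = |h_β|U₀` is small enough. Given `h_β ≤ h ≤ 0` and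
`ω ∈ O_h`, put `x⃗ = x'₁n⃗_h(θ_{h,ω}) + x'₂τ⃗_h(θ_{h,ω})` (2.51). Then, given `N ≥ 2`, there exists a
constant `C_N` such that
`|g^{(h)}_ω(x)| ≤ C_Nγ^{3h/2} / (1 + (γ^h|d_β(x₀)| + γ^h|x'₁|)^N + γ^{-h}(γ^h|x'₂|)^N)` (2.52), where
`d_β(x₀) = (β/π)sin(πx₀/β)`.*  Remark (p0010:L122): (2.52) implies `∫dx |x|^j|g^{(h)}_ω(x)| ≤ C_jγ^{-(1+j)h}`,
`j ≥ 0` (2.52a) — quoted, not typed (Remark 6).  `C_N` is uniform in `h, ω, β, U` (it may depend on `N`,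
`μ`, `e₀` and the constants `Cₙ` of (2.36)); `γ^{3h/2} = 2^{3h}`, `γ^h = 4^h`.  The tree PROVES the
`E_h ≡ ε`, continuum-`k₀` case in the STRONGER anisotropic form `(1 + |(γ^hx₀, γ^hx'₁, γ^{h/2}x'₂)|)^{-N}`:
`SectorPropagatorDecay.sectorPropagator_decay`; finite-`β` order zero: `norm_thermalSectorPropagator_le_of_scale`
(FACT-LIST F-002). BGM06.L2.2 · Lemma 2.2 · p0010:L107. [cite: BenfattoGiulianiMastropietro2006, §2.5 Lemma 2.2] -/
def BGM2006_Lemma_2_2 : Prop :=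
  ∀ (μ e₀ : ℝ), -4 < μ → μ < -2 - Real.sqrt 2 → BGMAdmissibleE0 μ e₀ → ∀ (C : ℕ → ℝ) (N : ℕ), 2 ≤ N →
    ∃ c₀ CN : ℝ, 0 < c₀ ∧
    ∀ (β U₀ U : ℝ) (hβ : ℤ), 0 < β → hβ ≤ 0 → |U| ≤ U₀ → |(hβ : ℝ)| * U₀ ≤ c₀ →
    ∀ E : ℤ → ℝ × (Fin 2 → ℝ) → ℂ, BGMInitial E → BGMSymmetry E → BGMSmoothness β U C hβ E →
    ∀ h : ℤ, hβ ≤ h → h ≤ 0 → ∀ ω : ℕ, ω < sectorCount (bgmScaleIdx h) →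
    ∀ (x₀ : ℝ) (x : Fin 2 → ℤ),
      ‖bgmSectorProp β e₀ μ E h ω x₀ x‖ ≤
        CN * (2 : ℝ) ^ (3 * h) /
          (1 + ((4 : ℝ) ^ h * |bgmDbeta β x₀| +
                (4 : ℝ) ^ h * |dot2 (fun i => (x i : ℝ))
                  (polarNormal (levelRadius (bgmEffDisp β E h) μ) (sectorCenter (bgmScaleIdx h) ω))|) ^ N +
            (4 : ℝ) ^ (-h) * ((4 : ℝ) ^ h * |dot2 (fun i => (x i : ℝ))
                  (polarTangent (levelRadius (bgmEffDisp β E h) μ) (sectorCenter (bgmScaleIdx h) ω))|) ^ N)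

/-- **Lemma 2.2a of BGM06** (the tadpole value gains `γ^h` by oddity). Printed: *Let us fix `h ≤ 0` and
`ω ∈ O_h`. Then `|g^{(h)}_ω(0)| ≤ Cγ^{5h/2}` (2.56a).*  Remark (p0011:L46): this is `γ^h` smaller than
(2.52).  Mechanism (proof, p0011:L48–L96, which the cell's p1 seat uses): write
`f_h = f̃_h(√(k₀²[1+a(θ)]² + e_θ(ρ)²)) + f^R_h` with `f̃_h(t) = H₀(γ^{-h}t) - H₀(γ^{-h+1}t)` (2.56bb) —
exactly the tree's one-variable shell `gnShell 4 e₀ h` of `ScaleCutoffs.lean` — and `f^R_h = O(γ^h)`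
supported slightly outside `supp f_h`; the `f̃_h`-part vanishes by oddity in `(k₀, e)` (2.56e), the rest
is `O(γ^{5h/2})` (2.56d).
Hypotheses: the standing ones of §2.5 made explicit (Remark 4).  `γ^{5h/2} = 2^{5h}`.  The tree PROVES
the `E_h ≡ ε`, continuum-`k₀` case: `SectorPropagatorAtZero.norm_sectorPropagator_zero_le` (with the
oddity step `masterScaleIntegral_zero`) (FACT-LIST F-003). BGM06.L2.2a · Lemma 2.2a · p0011:L40.
[cite: BenfattoGiulianiMastropietro2006, §2.5 Lemma 2.2a] -/
def BGM2006_Lemma_2_2a : Prop :=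
  ∀ (μ e₀ : ℝ), -4 < μ → μ < -2 - Real.sqrt 2 → BGMAdmissibleE0 μ e₀ → ∀ (C : ℕ → ℝ),
    ∃ c₀ C' : ℝ, 0 < c₀ ∧
    ∀ (β U₀ U : ℝ) (hβ : ℤ), 0 < β → hβ ≤ 0 → |U| ≤ U₀ → |(hβ : ℝ)| * U₀ ≤ c₀ →
    ∀ E : ℤ → ℝ × (Fin 2 → ℝ) → ℂ, BGMInitial E → BGMSymmetry E → BGMSmoothness β U C hβ E →
    ∀ h : ℤ, hβ ≤ h → h ≤ 0 → ∀ ω : ℕ, ω < sectorCount (bgmScaleIdx h) →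
      ‖bgmSectorProp β e₀ μ E h ω 0 0‖ ≤ C' * (2 : ℝ) ^ (5 * h)

/-- **Lemma 2.3 of BGM06** (decay of the isotropic propagators (2.59)). Printed: *Assume the bounds (2.36)
are valid and `c₀ = |h_β|U₀` is small enough. Given `h_β ≤ h ≤ 0`, `ω̄ ∈ Ō_h` and `N ≥ 0`, there exists a
constant `C_N` such that `|ḡ^{(h)}_ω̄(x)| ≤ C_Nγ^{2h} / (1 + (γ^h|d_β(x₀)| + γ^h|x⃗|)^N)` (2.60).*  Remark
(p0012:L6): (2.60) implies `∫dx |x|^j|ḡ^{(h)}_ω̄(x)| ≤ C_jγ^{-(1+j)h}` (2.52b), the same as for an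
anisotropic propagator — quoted, not typed.  `|x⃗|` Euclidean; `|Ō_h| = sectorCount (2n)` (Remark 2).
The tree PROVES the `E_h ≡ ε`, continuum-`k₀` case: `IsotropicPropagatorDecay.isoPropagator_decay`,
`isoPropagator_l1` (FACT-LIST F-004). BGM06.L2.3 · Lemma 2.3 · p0011:L154. [cite: BenfattoGiulianiMastropietro2006, §2.5 Lemma 2.3] -/
def BGM2006_Lemma_2_3 : Prop :=
  ∀ (μ e₀ : ℝ), -4 < μ → μ < -2 - Real.sqrt 2 → BGMAdmissibleE0 μ e₀ → ∀ (C : ℕ → ℝ) (N : ℕ),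
    ∃ c₀ CN : ℝ, 0 < c₀ ∧
    ∀ (β U₀ U : ℝ) (hβ : ℤ), 0 < β → hβ ≤ 0 → |U| ≤ U₀ → |(hβ : ℝ)| * U₀ ≤ c₀ →
    ∀ E : ℤ → ℝ × (Fin 2 → ℝ) → ℂ, BGMInitial E → BGMSymmetry E → BGMSmoothness β U C hβ E →
    ∀ h : ℤ, hβ ≤ h → h ≤ 0 → ∀ ω : ℕ, ω < sectorCount (2 * bgmScaleIdx h) →
    ∀ (x₀ : ℝ) (x : Fin 2 → ℤ),
      ‖bgmIsoProp β e₀ μ E h ω x₀ x‖ ≤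
        CN * (4 : ℝ) ^ (2 * h) /
          (1 + ((4 : ℝ) ^ h * |bgmDbeta β x₀| +
                (4 : ℝ) ^ h * Real.sqrt (((x 0 : ℝ)) ^ 2 + ((x 1 : ℝ)) ^ 2)) ^ N)

/-- **Lemma 2.2b of BGM06**. Printed: *Let us fix `h ≤ 0` and `ω̄ ∈ Ō_h`. Then `|ḡ^{(h)}_ω̄(0)| ≤ Cγ^{3h}`
(2.60a).*  Remark (p0012:L18): `γ^h` smaller than (2.60).  Hypotheses: the standing ones of §2.5 made
explicit (Remark 4).  The tree PROVES the `E_h ≡ ε`, continuum-`k₀` case: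
`IsotropicPropagatorAtZero.norm_isoPropagator_zero_le` (FACT-LIST F-005). BGM06.L2.2b · Lemma 2.2b · p0012:L14.
[cite: BenfattoGiulianiMastropietro2006, §2.5 Lemma 2.2b] -/
def BGM2006_Lemma_2_2b : Prop :=
  ∀ (μ e₀ : ℝ), -4 < μ → μ < -2 - Real.sqrt 2 → BGMAdmissibleE0 μ e₀ → ∀ (C : ℕ → ℝ),
    ∃ c₀ C' : ℝ, 0 < c₀ ∧
    ∀ (β U₀ U : ℝ) (hβ : ℤ), 0 < β → hβ ≤ 0 → |U| ≤ U₀ → |(hβ : ℝ)| * U₀ ≤ c₀ →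
    ∀ E : ℤ → ℝ × (Fin 2 → ℝ) → ℂ, BGMInitial E → BGMSymmetry E → BGMSmoothness β U C hβ E →
    ∀ h : ℤ, hβ ≤ h → h ≤ 0 → ∀ ω : ℕ, ω < sectorCount (2 * bgmScaleIdx h) →
      ‖bgmIsoProp β e₀ μ E h ω 0 0‖ ≤ C' * (4 : ℝ) ^ (3 * h)

/-! ### Small API -/

/-- `ℒ` keeps the two- and four-leg kernels ((2.20), `l = 1, 2`). [cite: BenfattoGiulianiMastropietro2006, §2.3 (2.20)] -/
@[simp] theorem bgmLocalize_one {α : Type*} [Zero α] (W : ℕ → α) : bgmLocalize W 1 = W 1 := by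
  simp [bgmLocalize]

/-- `ℒ` kills the kernels with `≥ 6` legs ((2.20), `l ≥ 3`). [cite: BenfattoGiulianiMastropietro2006, §2.3 (2.20)] -/
theorem bgmLocalize_of_three_le {α : Type*} [Zero α] (W : ℕ → α) {l : ℕ} (hl : 3 ≤ l) : bgmLocalize W l = 0 := by
  unfold bgmLocalize
  rw [if_neg]
  omega

/-- At the first step, with `E_0 ≡ ε`, the scale-`0` cutoff is `χ(k) = H₀(√(k₀² + (ε(k⃗) - μ)²))` of
(2.10), i.e. `1 - f₁`. [cite: BenfattoGiulianiMastropietro2006, §2.3 after (2.19)] -/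
theorem bgmCutoffInv_zero_of_initial {E : ℤ → ℝ × (Fin 2 → ℝ) → ℂ} (hE : BGMInitial E) (e₀ μ : ℝ)
    (p : ℝ × (Fin 2 → ℝ)) : bgmCutoffInv e₀ μ E 0 p = 1 - bgmUVCutoff e₀ μ p := by
  have hn : ‖bgmDenom μ E 0 p‖ = Real.sqrt (p.1 ^ 2 + (sqDispersion p.2 - μ) ^ 2) := by
    rw [bgmDenom, hE p, Complex.norm_eq_sqrt_sq_add_sq]
    congr 1
    simp only [Complex.add_re, Complex.neg_re, Complex.mul_re, Complex.I_re, Complex.ofReal_re,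
      Complex.I_im, Complex.ofReal_im, Complex.sub_re, Complex.add_im, Complex.neg_im, Complex.mul_im,
      Complex.sub_im]
    ring
  simp [bgmCutoffInv, bgmUVCutoff, gnScaleCutoff, hn]

/-- The BGM window for `μ` and the admissible `e₀` are jointly non-empty: `μ = -7/2`, `e₀ = 1/16`. [folklore] -/
example : (-4 : ℝ) < -7 / 2 ∧ (-7 / 2 : ℝ) < -2 - Real.sqrt 2 ∧ BGMAdmissibleE0 (-7 / 2) (1 / 16) := by
  have h2 : Real.sqrt 2 < 23 / 16 := by
    rw [Real.sqrt_lt' (by norm_num)]; norm_num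
  exact ⟨by norm_num, by linarith, by norm_num, by linarith, by norm_num⟩

end Literature.MathematicalPhysics.QuantumLattice.FermiRG
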